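import Summits.FinalStateConjecture.FinalStateConjecture.Theses.EIHFluxBalance

/-!
# Scratch (stub-worker S3b, NOT a proposal): the lemmas missing for `stub_slavingChargeIdentification`

None of the five statements below is in the tree (`lean search`), in the prior stockroom (`lean find`),
or on the ledger as a typed item; each is needed by the paper proof of the registered stub
(`briefs/stub_slavingChargeIdentification.md`). They are recorded here as elaborated `Prop`s so the
lead can register them as supports / reshape. `M5` is the genuinely hard one (the K1/K3′ "squeeze":
slaving WITH the rate `t^{1/2}‖u̇‖ → 0` that clause (i) needs on outer spheres `R ≍ t`, because the
painted `∂₀G` adds the exactly `R`-linear artefact `−(M R/3)·ḃ` to `P^k[G]`, cf. DrefuteChargeModel.md).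
-/

noncomputable section

namespace Summit.FinalStateConjecture.FinalStateConjecture.Theorems.S3bMissing

open scoped BigOperators Topology Manifold Classical MeasureTheory Matrix InnerProductSpace ContDiff ENNReal
open Filter Set Function TopologicalSpace MeasureTheory Literature.Geometry.Lorentzian

/-- **M1 · Ricci bridge for the lab metric of a vacuum development** (adaptation of the tree's
`ricci_immersedChart_eq_ricAt` / `OpensChart.ricci_eq_ricAt` to `Φ : U → 𝒟.carrier` on a subtype and to
the total field `B.bilin + deviationExtend`, which equals `pullbackBilin Φ g` on `U`; nondegeneracy of
the pulled-back components at `x` replaces injectivity of `dΦₓ`). Size M. -/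
def RicciFlatLabMetric : Prop :=
  ∀ (X : Type) [TopologicalSpace X] [ChartedSpace E3 X] [IsManifold (𝓡 3) ((⊤ : ℕ∞) : WithTop ℕ∞) X]
    [T2Space X] [SecondCountableTopology X] [ConnectedSpace X],
    ∀ D ∈ admissibleVacuumData X, ∀ 𝒟 : VacuumCauchyDevelopment D,
    ∀ (B : ModelBackground) (Φ : B.domain → 𝒟.carrier),
      ContMDiff 𝓘(ℝ, E4) (𝓡 4) ((⊤ : ℕ∞) : WithTop ℕ∞) Φ →
      ∀ x : B.domain,
        LandauLifshitz.metricDet (fun z : E4 ↦ B.bilin z + 𝒟.toSpacetime.deviationExtend B Φ z) x.1 ≠ 0 →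
        MetricCoord.ricAt (fun z : E4 ↦ B.bilin z + 𝒟.toSpacetime.deviationExtend B Φ z) x.1 = 0

/-- **M2 · exact Kerr–Schild charge of a FROZEN boosted hole on any enclosing lab sphere**:
`P^μ[boostedKerrBilin Λ c M a](S_R) = M · sgn(u⁰) · u^μ`, `u = Λe₀`, written with the stub's own
`|u⁰| = (√(1 − ‖v‖²))⁻¹`, `v = (u⁰)⁻¹ u̲`. Paper: `det g = det η` and `H` exactly linear in `f k⊗k`
for KS metrics, `emComplex[KS] ≡ 0` off `{r ≤ r₊}` (needs the named fact `Kerr.isRicciFlat` for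
`a ≠ 0`; `a = 0` is `SchwarzschildKerrSchildRicciFlat`), homology invariance of `∮ h^{μ0j} n_j` in the
vacuum region (a Stokes theorem on `E3` minus a compact set, not in Mathlib), Lorentz tensoriality of
`h`, and `P⁰ = M` for Kerr at rest. Size XL. -/
def KerrSchildExactCharge : Prop :=
  ∀ (Λ : lorentzGroup) (c : E4) (M a : ℝ), Kerr.IsSubextremal M a →
    ∀ (t : ℝ) (ξ : E3) (R : ℝ), 0 < R →
      (∀ y : E3, Kerr.radius a (poincareInv Λ c (E4.ofTimeSpace t y)) ≤ Kerr.rPlus M a → dist y ξ < R) →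
      LandauLifshitz.quasiLocalMomentum (boostedKerrBilin Λ c M a) t ξ R 0 =
          M * (√(1 - ‖((((Λ : E4 ≃L[ℝ] E4) (E4.basisVector 0)) 0)⁻¹ •
            E4.spatial ((Λ : E4 ≃L[ℝ] E4) (E4.basisVector 0)))‖ ^ 2))⁻¹ ∧
        ∀ k : Fin 3, LandauLifshitz.quasiLocalMomentum (boostedKerrBilin Λ c M a) t ξ R k.succ =
          M * (√(1 - ‖((((Λ : E4 ≃L[ℝ] E4) (E4.basisVector 0)) 0)⁻¹ •
            E4.spatial ((Λ : E4 ≃L[ℝ] E4) (E4.basisVector 0)))‖ ^ 2))⁻¹ *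
            (((((Λ : E4 ≃L[ℝ] E4) (E4.basisVector 0)) 0)⁻¹ •
              E4.spatial ((Λ : E4 ≃L[ℝ] E4) (E4.basisVector 0))) k)

/-- **M3 · perforated Gauss for the Landau–Lifshitz charge** (`Σ_j ∂_j h^{μ0j} = emComplex^{μ0}` since
`h^{μ00} ≡ 0`): outer sphere minus disjoint inner spheres = bulk integral of the complex over the
perforated ball, for components smooth and nondegenerate near it. Divergence theorem for a ball minus
balls with `μHE[2]` boundary measure — Mathlib has boxes only (`DivergenceTheoremCompactSupport` in the
tree is the boundaryless case). Size L. -/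
def PerforatedGauss : Prop :=
  ∀ (g : E4 → E4 →L[ℝ] E4 →L[ℝ] ℝ) (W : Set E4) (t : ℝ) (c : E3) (R : ℝ) (n : ℕ) (ξ : Fin n → E3)
    (ρ : Fin n → ℝ), IsOpen W → ContDiffOn ℝ ((⊤ : ℕ∞) : WithTop ℕ∞) g W →
    (∀ x ∈ W, LandauLifshitz.metricDet g x ≠ 0) → 0 < R → (∀ j, 0 < ρ j) →
    (∀ j, dist (ξ j) c + ρ j < R) → (∀ j j', j ≠ j' → ρ j + ρ j' < dist (ξ j) (ξ j')) →
    (∀ y : E3, dist y c ≤ R → (∀ j, ρ j ≤ dist y (ξ j)) → E4.ofTimeSpace t y ∈ W) →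
    ∀ μ : Fin 4,
      LandauLifshitz.quasiLocalMomentum g t c R μ - ∑ j, LandauLifshitz.quasiLocalMomentum g t (ξ j) (ρ j) μ =
        ∫ y in {y : E3 | dist y c ≤ R ∧ ∀ j, ρ j ≤ dist y (ξ j)},
          LandauLifshitz.emComplex g (E4.ofTimeSpace t y) μ 0

/-- **M4 · the densitised LL complex is quadratic in first derivatives in vacuum** (LL (96.8)–(96.9) as a
bound; verbatim the first lead's `stub_pseudotensorBound`, line sublinear-is-free-clean-window-charges,
not landed): with `emComplex = (−g)(G/8π + t_LL)` (proved: `llBalanceLaw_pointwise`) and `G = 0` this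
bounds the bulk integrand of M3 by `C‖Dg‖²`. Size XL (symbolic). -/
def PseudotensorBound : Prop :=
  ∃ C : ℝ, 0 ≤ C ∧ ∀ (g : E4 → E4 →L[ℝ] E4 →L[ℝ] ℝ) (x : E4) (b : ℝ), ContDiffAt ℝ 2 g x →
    (∀ᶠ y in 𝓝 x, ∀ v w : E4, g y v w = g y w v) → ‖g x - Minkowski.bilin‖ ≤ 1 / 2 →
    (∀ v : E4, ‖fderiv ℝ g x v‖ ≤ b * ‖v‖) →
    ∀ μ ν : Fin 4, |LandauLifshitz.metricDet g x * LandauLifshitz.pseudotensor g x μ ν| ≤ C * b ^ 2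

/-- **M5 · slaving WITH RATE from the vacuum constraints (the K1/K3′ squeeze)** — under the full crux
antecedent (abbreviated here to its data; the lead's generator `gen/ANTE.txt` supplies the text): the
painted 4-velocities `uᵢ = Λᵢe₀` satisfy `t^{1/2}‖u̇ᵢ‖ → 0` and (for `aᵢ ≠ 0`) the painted axes
`t^{1/2}‖(Λᵢe₃)˙‖ → 0`, and the centres are slaved, `ξ̇ᵢ − vᵢ → 0`. Mechanism: `Ric(Φ^*g) = 0` (M1) ⇒ the
vacuum CONSTRAINTS of the painted slice family `(λ, λ̇) ↦ 𝒞(λ, λ̇)` tend to `0` near each hole; the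
momentum constraint is AFFINE in `λ̇`, injective modulo the Kerr stabiliser (kit j005733 at `a = 0`
only; `a ≠ 0` unchecked), `Λ` ranges in a compact set (`|u⁰| ≤ γ`) ⇒ `λ̇ − λ̇_stat → 0`; the RATE needs
the weighted `m = 1` clause at `d ≍ t` against the `‖u̇‖M/d` painted artefact ("backward reading").
Stated here only as the shape of the conclusion for one hole's data. Size XL; no Lean route today. -/
def SlavingWithRate (N : ℕ) (a : Fin N → ℝ) (Λ : Fin N → ℝ → lorentzGroup) (ξ : Fin N → ℝ → E3) : Prop :=
  ∀ i : Fin N,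
    Tendsto (fun t ↦ deriv (ξ i) t - (((((Λ i t : lorentzGroup) : E4 ≃L[ℝ] E4) (E4.basisVector 0)) 0)⁻¹ •
      E4.spatial (((Λ i t : lorentzGroup) : E4 ≃L[ℝ] E4) (E4.basisVector 0)))) atTop (𝓝 0) ∧
    Tendsto (fun t ↦ √t * ‖deriv (fun s ↦ ((Λ i s : lorentzGroup) : E4 ≃L[ℝ] E4) (E4.basisVector 0)) t‖)
      atTop (𝓝 0) ∧
    (a i ≠ 0 → Tendsto (fun t ↦ √t *
      ‖deriv (fun s ↦ ((Λ i s : lorentzGroup) : E4 ≃L[ℝ] E4) (E4.basisVector 3)) t‖) atTop (𝓝 0))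

end Summit.FinalStateConjecture.FinalStateConjecture.Theorems.S3bMissing

end
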